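import Summits.NavierStokesRegularity.NavierStokesRegularity.Theorems.ExtremiserTransienceNearExtremalTransiencePerFlowOfPorousZone
import HarnessLib

noncomputable section
open scoped Topology InnerProductSpace RealInnerProductSpace ENNReal ContDiff
open MeasureTheory Filter Set Metric
open Literature.Analysis.FluidPDE

namespace Summit.NavierStokesRegularity.NavierStokesRegularity.Cruxes.NearExtremalTransiencePerFlow.Sketch
set_option linter.dupNamespace false
set_option linter.style.longLine false

/-- **REL (first lemma of the idea «nondegenerate-extremal-curve»; PROVABLE, M/L).**  Relative-equilibrium Liouville in the decaying
class, amplitude × translations: a classical Leray–Hopf flow from rapidly decaying data that is SHAPE-PRESERVING modulo amplitude and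
translation on a time interval has zero vortex stretching there (indeed the proof gives `u(t₀) = 0`: homogeneity in the strictly
decreasing amplitude splits the equation into `νΔφ = c₀φ + b₀·∇φ`, whose only `L²` solution is `0` by Fourier support on a sphere). -/
def RelEquilibriumNoStretching : Prop :=
  ∀ (ν T : ℝ), 0 < ν → 0 < T →
  ∀ (u : ℝ → EuclideanSpace ℝ (Fin 3) → EuclideanSpace ℝ (Fin 3)) (p : ℝ → EuclideanSpace ℝ (Fin 3) → ℝ),
    IsClassicalNSSolutionOn (Set.Ico 0 T) ν 0 u p → IsLerayHopfOn T ν 0 (u 0) u → HasRapidSpatialDecay (u 0) →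
  ∀ (t₀ s : ℝ), 0 < t₀ → 0 < s → t₀ + s < T →
    (∃ (a : ℝ → ℝ) (ξ : ℝ → EuclideanSpace ℝ (Fin 3)), ∀ t ∈ Set.Icc t₀ (t₀ + s), ∀ x, u t x = a t • u t₀ (x - ξ t)) →
    ∫ x, ⟪curl (u t₀) x, fderiv ℝ (u t₀) x (curl (u t₀) x)⟫_ℝ = 0

/-- **E2♯ (decaying-class shadow of «no extremal curve», the qualitative heart behind X / X♭; OPEN as a uniform statement, its exact
version is the tree theorem `ExtremiserTransience.slice_lt_sharp`).**  Typed here in the NEAR form that C♭-compactness would feed: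
for every window length there is a deficit below which no admissible window is near-extremal at every instant. -/
def NoNearExtremalWindow : Prop :=
  ∀ (Θ G H τ₁ : ℝ), 0 < Θ → 0 < G → 0 < H → 0 < τ₁ → ∃ ε : ℝ, 0 < ε ∧
    ∀ (ν T : ℝ), 0 < ν → 0 < T →
    ∀ (u : ℝ → EuclideanSpace ℝ (Fin 3) → EuclideanSpace ℝ (Fin 3)) (p : ℝ → EuclideanSpace ℝ (Fin 3) → ℝ),
      IsClassicalNSSolutionOn (Set.Ico 0 T) ν 0 u p → IsLerayHopfOn T ν 0 (u 0) u → HasRapidSpatialDecay (u 0) →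
    ∀ (t M : ℝ), 0 ≤ t → 0 < M → t + τ₁ * ν / M ^ 2 < T →
      (∀ x, ‖u t x‖ ≤ M) →
      (∫ x, ‖curl (u t) x‖ ^ 2) ≤ Θ * (ν / M) ^ 2 * (∫ x, frobeniusNormSq (fderiv ℝ (curl (u t)) x)) →
      (∀ x, ‖fderiv ℝ (u t) x‖ ≤ G * M ^ 2 / ν) →
      (∀ t' ∈ Set.Icc t (t + τ₁ * ν / M ^ 2), ∀ x, ‖u t' x‖ ≤ H * M) →
      ∃ t' ∈ Set.Icc t (t + τ₁ * ν / M ^ 2), ∀ M' : ℝ, (∀ x, ‖u t' x‖ ≤ M') →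
        |∫ x, ⟪curl (u t') x, fderiv ℝ (u t') x (curl (u t') x)⟫_ℝ| ≤
          (Summit.NavierStokesRegularity.NavierStokesRegularity.Theorems.DepletionLadder.KStar.HalfSpace.kStar - ε) * M' *
            Real.sqrt (∫ x, ‖curl (u t') x‖ ^ 2) * Real.sqrt (∫ x, frobeniusNormSq (fderiv ℝ (curl (u t')) x))

end Summit.NavierStokesRegularity.NavierStokesRegularity.Cruxes.NearExtremalTransiencePerFlow.Sketch
end
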